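import Literature.Analysis.Asymptotics.LaplaceMethodSeveralOrbits
import Literature.Analysis.Asymptotics.LaplaceMethodChartComposition
import Literature.MeasureTheory.Group.HaarLocalChart
import HarnessLib

/-!
# Laplace's method on non-degenerate critical orbits — the COMPACT ∕ CONTINUOUS edition
(all measurability, integrability, separation and slice hypotheses discharged from topology)

Topic `Literature/Analysis/Asymptotics`; namespace `Literature.Analysis.Asymptotics`.  Sequel of
`LaplaceMethodOrbit.lean` (★★ `tendsto_laplaceMethod_orbit`), `LaplaceMethodSeveralOrbits.lean`
(★★ `tendsto_laplaceMethod_orbit_indicator`, ★ `tendsto_laplaceMethod_sum_of_tubes`) and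
`MeasureTheory/Group/OrbitTubeMeasure.lean` (★ `exists_nhds_slice_of_locallyInjective`).  Everything here is
PROVED; no definitions, no named facts.

WHY THIS FILE.  The landed one-orbit theorem carries some thirty hypotheses, two thirds of which are «soft»:
measurability of the tube `Θ(K × B)` and of the window image `Θ'(Φ × B)`, integrability ∕ continuity ∕ boundedness
of the averaged chart density `y ↦ ∫_Φ J(z, y) dκ`, integrability of the weight, positivity and finiteness of the
group-window constant `c = ν(((eΦ)·S)⁻¹)`, the separation `hsep` of `f∘σ` from its minimum, and the SLICE PROPERTY
`act k (σ y) = σ y' ⟹ k ∈ S`.  In the setting where such theorems are used — a COMPACT metrisable group `K` with a Haar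
measure `ν` acting jointly continuously by measure-preserving maps on a COMPACT metrisable space `X` with a finite
measure `μ`; continuous transversal `σ`, group chart `e`, phase `f` and amplitude `φ`; a local product chart
`Θ'(z, y) = e(z) • σ(y)` with a continuous density on an open window `W ∋ 0` (the output format of an
inverse-function-theorem chart, e.g. the twisted-slab fibred slice chart of cell `ym-ir`) — ALL of them follow from
topology, and this file derives them once:

* §1 the dischargers: `measurableSet_image_prod_ball`, `measurableSet_image_ball_prod_ball` (tubes and window
  images over compact × ball data are σ-compact images, hence Borel); ★ `exists_ball_slice_of_chart` (the slice
  property on a small ball from: stabiliser of `σ 0` inside `S`, `S` fixes `σ(V)`, `Θ'` injective on a neighbourhood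
  of `0`, `e` open at `0` with `e 0 = 1` — via the topological slice lemma); `image_mul_mem_nhds_one_of_chart`
  (`(eΦ)·S` is a neighbourhood of `1` as soon as the chart is open at the origin) and
  `measure_windowConst_ne_zero_of_chart` (so `0 < c = ν(((eΦ)·S)⁻¹) < ∞` for a Haar measure); `density_window_data`
  (integrability, continuity at `0` and a uniform bound for `y ↦ ∫_{ball ρ} J(z, y) dκ` from continuity of `J` on
  `W ⊇ closedBall ρ × closedBall r₀`); `exists_ball_quadratic_lower_bound` (`f(σ y) − f(σ 0) ≥ (c∕4)‖y‖²` near `0`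
  from the Peano expansion and coercivity — this is `hsep`); `tube_mem_nhds_orbit` (the tube is a neighbourhood
  of every point of the orbit).
* §2 ★★★ `tendsto_laplaceMethod_orbit_indicator_of_continuous` — the one-orbit theorem for the localised
  amplitude `1_{T_r} φ`, `T_r = Θ(K × ball 0 r)`, with ONLY structural hypotheses; conclusion: there is `r₁ > 0`
  such that for every `0 < r ≤ r₁`,
  `β^{m/2} ∫_X e^{−β(f − f(σ0))} 1_{T_r} φ dμ ⟶ (2π)^{m/2} ν(K) ((∫_{ball ρ} J(z,0)dκ) ∕ ν(((e(ball ρ))·S)⁻¹)) φ(σ0) ∕ √det A`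
  (the freedom in `r` is what the several-orbit bookkeeping needs to make the tubes disjoint); companion
  `act_orbit_mem_tube` (the tube contains the orbit).
* §3 ★★★ `tendsto_laplaceMethod_sum_orbits_of_continuous` — finitely many non-degenerate critical orbits
  `K • σ_i(0)` (`i ∈ ι` finite, transversals ∕ charts of one common model `Z × V`): if `f ≥ f₀` everywhere and
  `{f = f₀} ⊆ ⋃_i K • σ_i(0)` with the orbits pairwise distinct, then
  `β^{m/2} ∫_X e^{−β(f − f₀)} φ dμ ⟶ Σ_i ℓ_i` with the explicit one-orbit constants `ℓ_i` — the tail hypothesis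
  `hout` of `tendsto_laplaceMethod_sum_of_tubes` and the pairwise disjointness of the tubes being DERIVED by
  compactness (`exists_pos_forall_le_of_notMem`, `exists_pos_forall_act_ne`); and the Gibbs-ratio corollary ★
  `tendsto_gibbs_expectation_sum_orbits_of_continuous` (`ι` non-empty, `κ` positive on open sets, `J_i(0,0) > 0`):
  `∫ e^{−βf} φ dμ ∕ ∫ e^{−βf} dμ ⟶ (Σ_i C_i φ(σ_i 0)) ∕ Σ_i C_i`, `C_i > 0` the orbit constants.

CONSUMER RECIPE (cell `ym-ir`, row 43, the twist-eating ladder on `SU(N)^E`; names of the LEAD's K-files): `act :=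
gaugeAct`, `K := 𝒢 = (sites → SU(N))` with `ν := Measure.pi haar` (a Haar measure), `X := SU(N)^E` with its Haar
probability `μ`, `σ := sliceCfg ∘ T_V`, `e := expGauge ∘ T_M`, `Θ' := fibredChartMap (prodFrame T_M T_V)` (K18
`fibredChartMap_prodFrame` is `hΘ'`), `W := ball 0 r ×ˢ ball 0 r` with `hinj ∕ hJc ∕ hchart` := K20a
`exists_ball_prod_hloc_ladder` (`(vol_M.prod vol_V)` is `κ.prod volume` with `κ := volume`), `ρ := r∕2`; `hstab` := K2
`gaugeAct_ladder_pair_eq_self_iff_specialUnitary` (`S` := the central constant gauge transformations), `hfix` := central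
constants act trivially; `hΘ'𝓝` := K15b `map_nhds_slicePsiSu_zero` composed with the B89 exponential chart; `he𝓝` := the
exponential chart of `𝒢` is open at `0`; `hAs ∕ hpos ∕ hS2` := K19 `sliceHessian_isSymmetric ∕ sliceHessian_pos ∕
isLittleO_slicePhase_taylor_two` (POINTWISE positivity suffices — coercivity is derived here); for §3, `{f = 0} =` the
`N²` ladder orbits (K7 + the flat classification) and their distinctness (K2 `ladder_pair_labels_unique_specialUnitary`).

HONEST SCOPE.  Asymptotic analysis ∕ measure theory at fixed everything else (one box); nothing uniform in auxiliary
parameters; nothing here bears on the Yang–Mills mass gap (Clay), which is NOT proved; in cell `ym-ir` the rung served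
(`R4`) closes only the conditional finite-`𝕋⁴` statement `BalabanLadder.UV`.

## References
* E. Hasenpflug, D. Rudolf, B. Sprungk, *Wasserstein convergence rates of increasingly concentrating probability
  measures*, Ann. Appl. Probab. 34 (2024): §3.1 Assumption 3 (M)(T), §3.4, App. 4.1 Thm 16 ∕ Remark 17.
  [HasenpflugRudolfSprungk2024]
* C.-R. Hwang, *Laplace's method revisited: weak convergence of probability measures*, Ann. Probab. 8 (1980)
  1177–1182, main theorem and Cor. (the limit of the Gibbs measures `e^{−βf}dμ ∕ Z_β`). [Hwang1980]
* K. W. Breitung, *Asymptotic Approximations for Probability Integrals*, LNM 1592 (1994): Lemma 40 p. 55, Thm 41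
  p. 56, Thm 56 (6.31). [Breitung1994]
* G. E. Bredon, *Introduction to Compact Transformation Groups* (1972), Ch. II §§4–5 (tubes and slices). [Bredon1972]
* C. Searle, in Dearricott et al., LNM 2110 (2014), Def. 1.11 and (1)–(7), PDF pp. 34–35. [DearricottEtAl2014]
* S. Helgason, *Groups and Geometric Analysis* (2000), Ch. I §1 Thm 1.14 p. 96 (Haar measure of compact groups in
  charts; unimodularity). [Helgason2000]
-/

noncomputable section

open _root_.MeasureTheory _root_.MeasureTheory.Measure _root_.Filter _root_.Set _root_.Module _root_.Metric
open scoped _root_.Topology _root_.Real _root_.InnerProductSpace _root_.ENNReal _root_.NNReal _root_.Pointwise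

namespace Literature.Analysis.Asymptotics

open Literature.MeasureTheory.Group

/-! ## §1 The soft hypotheses, from topology -/

section SigmaCompact

variable {X : Type*} [TopologicalSpace X] [T2Space X] [MeasurableSpace X] [OpensMeasurableSpace X]

/-- An open ball is the countable union of the closed balls of rational radii below its radius. [folklore] -/
private theorem ball_eq_iUnion_closedBall_rat {Y : Type*} [PseudoMetricSpace Y] (y₀ : Y) (r : ℝ) :
    ball y₀ r = ⋃ q : {q : ℚ // (q : ℝ) < r}, closedBall y₀ (q : ℝ) := by
  ext y
  simp only [mem_iUnion, mem_ball, mem_closedBall]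
  constructor
  · intro hy
    obtain ⟨q, hq1, hq2⟩ := exists_rat_btwn hy
    exact ⟨⟨q, hq2⟩, hq1.le⟩
  · rintro ⟨⟨q, hq⟩, hy⟩
    exact lt_of_le_of_lt hy hq

/-- **Tubes over compact × ball data are measurable**: for a continuous `Θ : P × Y → X` (`X` Hausdorff, `Y` proper),
a compact `C ⊆ P` and a ball of `Y`, the image `Θ(C × ball)` is σ-compact, hence Borel (e.g. the orbit tube
`Θ(K × ball 0 r)` of a compact group `K`). [cite: Bredon1972, Ch. II §5]
[cite: DearricottEtAl2014, (Searle) Def. 1.11 and property (1), PDF p. 34] -/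
theorem measurableSet_image_prod_ball {P Y : Type*} [TopologicalSpace P] [PseudoMetricSpace Y] [ProperSpace Y]
    {Θ : P × Y → X} (hΘ : Continuous Θ) {C : Set P} (hC : IsCompact C) (y₀ : Y) (r : ℝ) :
    MeasurableSet (Θ '' (C ×ˢ ball y₀ r)) := by
  rw [ball_eq_iUnion_closedBall_rat, prod_iUnion, image_iUnion]
  exact MeasurableSet.iUnion fun q => measurableSet_image_prod_of_isCompact hΘ hC (isCompact_closedBall _ _)

/-- **Window images over ball × ball data are measurable** (σ-compactness again; no injectivity ∕ Lusin–Souslin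
needed). [cite: Breitung1994, §2.3 Definitions 4–5 pp. 14–15 (local coordinates)] -/
theorem measurableSet_image_ball_prod_ball {Y₁ Y₂ : Type*} [PseudoMetricSpace Y₁] [ProperSpace Y₁]
    [PseudoMetricSpace Y₂] [ProperSpace Y₂] {Θ : Y₁ × Y₂ → X} (hΘ : Continuous Θ) (z₀ : Y₁) (ρ : ℝ) (y₀ : Y₂)
    (r : ℝ) : MeasurableSet (Θ '' (ball z₀ ρ ×ˢ ball y₀ r)) := by
  rw [ball_eq_iUnion_closedBall_rat z₀ ρ, iUnion_prod_const, image_iUnion]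
  exact MeasurableSet.iUnion fun q => measurableSet_image_prod_ball hΘ (isCompact_closedBall _ _) y₀ r

end SigmaCompact

section Slice

variable {K X Z V : Type*} [Group K] [TopologicalSpace K] [TopologicalSpace X] [TopologicalSpace Z] [Zero Z]
  [SeminormedAddCommGroup V] {act : K → X → X} {σ : V → X} {e : Z → K} {Θ' : Z × V → X} {S : Set K}

/-- ★ **The slice property on a small ball, from the chart.**  A sequentially compact group `K` acts on a
Hausdorff space `X` by a jointly continuous family; `σ` is continuous at `0`; the stabiliser of `σ 0` lies in a set
`S` fixing `σ(V)` pointwise; the local product chart `Θ'(z, y) = e(z) • σ(y)` is injective on a neighbourhood `W`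
of the origin, and the group chart `e` is open at `0` with `e 0 = 1` (every `k` near `1` is an `e z`, `z` near `0`).
Then for some `r > 0`: `k • σ y = σ y'` with `‖y‖, ‖y'‖ < r` forces `k ∈ S` and `y = y'`.  (Local injectivity
near `(1, 0)` in the form the topological slice lemma wants is read off the chart: `k = e z`, `σ y' = e 0 • σ y'`.)
[cite: Bredon1972, Ch. II §§4–5] [cite: DearricottEtAl2014, (Searle) Def. 1.11 and property (1), PDF pp. 34–35] -/
theorem exists_ball_slice_of_chart [SeqCompactSpace K] [ContinuousMul K] [T2Space X]
    (hcont : Continuous fun p : K × X => act p.1 p.2)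
    (hmul : ∀ k k' x, act (k * k') x = act k (act k' x)) (hone : ∀ x, act 1 x = x)
    (hσ : ContinuousAt σ 0) (he1 : e 0 = 1) (he𝓝 : 𝓝 (1 : K) ≤ map e (𝓝 0))
    (hΘ' : ∀ z y, Θ' (z, y) = act (e z) (σ y)) {W : Set (Z × V)} (hW : W ∈ 𝓝 ((0 : Z), (0 : V)))
    (hinj : InjOn Θ' W)
    (hstab : ∀ k : K, act k (σ 0) = σ 0 → k ∈ S) (hfix : ∀ s ∈ S, ∀ y, act s (σ y) = σ y) :
    ∃ r : ℝ, 0 < r ∧ ∀ k : K, ∀ y ∈ ball (0 : V) r, ∀ y' ∈ ball (0 : V) r,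
      act k (σ y) = σ y' → k ∈ S ∧ y = y' := by
  obtain ⟨U₁, hU₁, U₂, hU₂, hUW⟩ := mem_nhds_prod_iff.1 hW
  have hU : e '' U₁ ∈ 𝓝 (1 : K) := he𝓝 (image_mem_map hU₁)
  have hinj' : ∀ k ∈ e '' U₁, ∀ y ∈ U₂, ∀ y' ∈ U₂, act k (σ y) = σ y' → k = 1 ∧ y = y' := by
    rintro k ⟨z, hz, rfl⟩ y hy y' hy' hk
    have h1 : Θ' (z, y) = Θ' (0, y') := by rw [hΘ', hΘ', he1, hone]; exact hk
    have h2 := hinj (hUW ⟨hz, hy⟩) (hUW ⟨mem_of_mem_nhds hU₁, hy'⟩) h1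
    obtain ⟨hz0, hyy'⟩ := Prod.mk.inj h2
    exact ⟨by rw [hz0, he1], hyy'⟩
  obtain ⟨W₀, hW₀, hslice⟩ :=
    exists_nhds_slice_of_locallyInjective hcont hmul hone hσ hstab hfix hU hU₂ hinj'
  obtain ⟨r, hr, hrW⟩ := Metric.mem_nhds_iff.1 hW₀
  exact ⟨r, hr, fun k y hy y' hy' h => hslice k y (hrW hy) y' (hrW hy') h⟩

/-- **The group window meets a neighbourhood of `1`**: if the chart `Θ'(z, y) = e(z) • σ(y)` is open at the origin
(`Θ'` maps neighbourhoods of `0` to neighbourhoods of `σ 0 = Θ'(0, 0)`) and the slice property holds on `B ∋ 0`, then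
for every neighbourhood `Φ` of `0` the set `(eΦ)·S` is a neighbourhood of `1` in `K` (every `k` with `k • σ 0` in the
window image `Θ'(Φ × B)` lies in it).  Hence `ν((eΦ)·S) > 0` for any measure positive on open sets — the constant
`c` of the tube formula is positive. [cite: Bredon1972, Ch. II §§4–5 (the tube `K ×_S B` is a neighbourhood of the orbit)]
[cite: DearricottEtAl2014, (Searle) Def. 1.11 and properties (1)–(3), PDF pp. 34–35] -/
theorem image_mul_mem_nhds_one_of_chart
    (hcont : Continuous fun p : K × X => act p.1 p.2)
    (hmul : ∀ k k' x, act (k * k') x = act k (act k' x)) (hone : ∀ x, act 1 x = x)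
    (hΘ' : ∀ z y, Θ' (z, y) = act (e z) (σ y)) (hΘ'𝓝 : 𝓝 (σ 0) ≤ map Θ' (𝓝 ((0 : Z), (0 : V))))
    {Φ : Set Z} (hΦ : Φ ∈ 𝓝 (0 : Z)) {B : Set V} (hB : B ∈ 𝓝 (0 : V))
    (hslice : ∀ k : K, ∀ y ∈ B, ∀ y' ∈ B, act k (σ y) = σ y' → k ∈ S) :
    (e '' Φ) * S ∈ 𝓝 (1 : K) := by
  have himg : Θ' '' (Φ ×ˢ B) ∈ 𝓝 (σ 0) := hΘ'𝓝 (image_mem_map (prod_mem_nhds hΦ hB))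
  have horb : Continuous fun k : K => act k (σ 0) := hcont.comp (continuous_id.prodMk continuous_const)
  have h1 : (fun k : K => act k (σ 0)) ⁻¹' (Θ' '' (Φ ×ˢ B)) ∈ 𝓝 (1 : K) := by
    refine horb.continuousAt.preimage_mem_nhds ?_
    rw [hone]
    exact himg
  refine mem_of_superset h1 ?_
  rintro k ⟨⟨z, y⟩, ⟨hz, hy⟩, hk⟩
  have hk' : act (e z) (σ y) = act k (σ 0) := by rw [← hΘ']; exact hk
  -- `(e z)⁻¹ k` moves `σ 0` to `σ y`, hence lies in `S`
  have h2 : act ((e z)⁻¹ * k) (σ 0) = σ y := by rw [hmul, ← hk', act_inv_act hmul hone]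
  have h3 : (e z)⁻¹ * k ∈ S := hslice _ 0 (mem_of_mem_nhds hB) y hy h2
  rw [← mul_inv_cancel_left (e z) k]
  exact Set.mul_mem_mul ⟨z, hz, rfl⟩ h3

end Slice

section Density

variable {Z V : Type*} [MetricSpace Z] [ProperSpace Z] [SeminormedAddCommGroup V] [ProperSpace V]
  [MeasurableSpace Z] [OpensMeasurableSpace Z] {κ : Measure Z} [IsFiniteMeasureOnCompacts κ]

/-- **The averaged chart density is integrable, continuous at `0` and locally bounded** when the density `J` is
continuous on an open `W ⊇ closedBall z₀ ρ × closedBall 0 r₀` and `κ` is finite on compact sets: for `‖y‖ ≤ r₀`,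
`z ↦ J(z, y)` is integrable on `ball z₀ ρ`, `y ↦ ∫_{ball z₀ ρ} J(z, y) dκ` is continuous at `0`, and
`|∫_{ball z₀ ρ} J(z, y) dκ| ≤ C` for `‖y‖ ≤ r₀` (dominated convergence with a constant majorant).
[cite: Breitung1994, Thm 41 p. 56 (continuity of the transversal data) with §2.3 pp. 14–15]
[cite: HasenpflugRudolfSprungk2024, App. 4.1 Thm 16 ∕ Remark 17] -/
theorem density_window_data {J : Z × V → ℝ} {W : Set (Z × V)} (hWo : IsOpen W) (hJc : ContinuousOn J W)
    {z₀ : Z} {ρ r₀ : ℝ} (hr₀ : 0 < r₀) (hsub : closedBall z₀ ρ ×ˢ closedBall (0 : V) r₀ ⊆ W) :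
    (∀ y ∈ closedBall (0 : V) r₀, IntegrableOn (fun z => J (z, y)) (ball z₀ ρ) κ) ∧
      ContinuousAt (fun y => ∫ z in ball z₀ ρ, J (z, y) ∂κ) 0 ∧
      ∃ C : ℝ, ∀ y ∈ closedBall (0 : V) r₀, |∫ z in ball z₀ ρ, J (z, y) ∂κ| ≤ C := by
  obtain ⟨M₀, hM₀⟩ := ((isCompact_closedBall z₀ ρ).prod (isCompact_closedBall (0 : V) r₀)).exists_bound_of_continuousOn
    (hJc.mono hsub)
  have hcy : ∀ y ∈ closedBall (0 : V) r₀, ContinuousOn (fun z => J (z, y)) (closedBall z₀ ρ) := fun y hy =>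
    hJc.comp (continuous_id.prodMk continuous_const).continuousOn fun z hz => hsub ⟨hz, hy⟩
  have hint : ∀ y ∈ closedBall (0 : V) r₀, IntegrableOn (fun z => J (z, y)) (ball z₀ ρ) κ := fun y hy =>
    ((hcy y hy).integrableOn_compact (isCompact_closedBall z₀ ρ)).mono_set ball_subset_closedBall
  have hballnhds : closedBall (0 : V) r₀ ∈ 𝓝 (0 : V) := closedBall_mem_nhds 0 hr₀
  have hμball : κ (ball z₀ ρ) < ∞ := lt_of_le_of_lt (measure_mono ball_subset_closedBall)
    (isCompact_closedBall z₀ ρ).measure_lt_top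
  refine ⟨hint, ?_, ⟨M₀ * κ.real (ball z₀ ρ), fun y hy => ?_⟩⟩
  · refine continuousAt_of_dominated (bound := fun _ => M₀) ?_ ?_ ?_ ?_
    · filter_upwards [hballnhds] with y hy
      exact ((hcy y hy).mono ball_subset_closedBall).aestronglyMeasurable measurableSet_ball
    · filter_upwards [hballnhds] with y hy
      exact ae_restrict_of_forall_mem measurableSet_ball fun z hz => hM₀ (z, y) ⟨ball_subset_closedBall hz, hy⟩
    · exact integrableOn_const hμball.ne
    · refine ae_restrict_of_forall_mem measurableSet_ball fun z hz => ?_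
      have hzW : (z, (0 : V)) ∈ W := hsub ⟨ball_subset_closedBall hz, mem_closedBall_self hr₀.le⟩
      exact (hJc.continuousAt (hWo.mem_nhds hzW)).comp (continuousAt_const.prodMk continuousAt_id)
  · rw [← Real.norm_eq_abs]
    exact norm_setIntegral_le_of_norm_le_const hμball fun z hz => hM₀ (z, y) ⟨ball_subset_closedBall hz, hy⟩

end Density

section Separation

variable {V X : Type*} [NormedAddCommGroup V] [InnerProductSpace ℝ V] {σ : V → X} {f : X → ℝ} {A : V →ₗ[ℝ] V}

/-- **Quadratic lower bound near a non-degenerate minimum** (`hsep` from the Peano expansion): if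
`f(σ y) = f(σ 0) + ½⟪Ay, y⟫ + o(‖y‖²)` and `c‖y‖² ≤ ⟪Ay, y⟫` (`c > 0`), then `f(σ y) − f(σ 0) ≥ (c∕4)‖y‖²` on a ball
around `0`; in particular `f(σ 0) + (c∕4)δ² ≤ f(σ y)` for `δ ≤ ‖y‖` there.
[cite: Breitung1994, Lemma 40 p. 55 and Thm 41 p. 56 (proof: the quadratic form controls `f − f(x*)` near `x*`)] -/
theorem exists_ball_quadratic_lower_bound {c : ℝ} (hc : 0 < c) (hcoer : ∀ y, c * ‖y‖ ^ 2 ≤ ⟪A y, y⟫_ℝ)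
    (hS2 : (fun y => f (σ y) - f (σ 0) - (1 / 2) * ⟪A y, y⟫_ℝ) =o[𝓝 0] fun y => ‖y‖ ^ 2) :
    ∃ r : ℝ, 0 < r ∧ ∀ y ∈ ball (0 : V) r, c / 4 * ‖y‖ ^ 2 ≤ f (σ y) - f (σ 0) := by
  have hev := hS2.def (by positivity : (0 : ℝ) < c / 4)
  obtain ⟨r, hr, h⟩ := Metric.eventually_nhds_iff.1 hev
  refine ⟨r, hr, fun y hy => ?_⟩
  have h1 := h (y := y) (by rwa [mem_ball] at hy)
  rw [Real.norm_eq_abs, Real.norm_eq_abs, abs_of_nonneg (by positivity : (0 : ℝ) ≤ ‖y‖ ^ 2)] at h1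
  have h2 := hcoer y
  have h3 := (abs_le.1 h1).1
  nlinarith

end Separation

section TubeBasic

variable {K X V : Type*} [Zero V] {act : K → X → X} {σ : V → X} {Θ : K × V → X}

/-- The orbit tube `Θ(K × B)` contains the orbit of `σ 0` when `0 ∈ B`. [cite: Bredon1972, Ch. II §4] -/
theorem act_orbit_mem_tube (hΘ : ∀ k y, Θ (k, y) = act k (σ y)) {B : Set V} (h0 : (0 : V) ∈ B) (k : K) :
    act k (σ 0) ∈ Θ '' (univ ×ˢ B) :=
  ⟨(k, 0), ⟨mem_univ _, h0⟩, hΘ k 0⟩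

end TubeBasic

section TubeNhds

variable {K X Z V : Type*} [Group K] [TopologicalSpace K] [TopologicalSpace X]
  [TopologicalSpace Z] [Zero Z] [SeminormedAddCommGroup V]
  {act : K → X → X} {σ : V → X} {e : Z → K} {Θ : K × V → X} {Θ' : Z × V → X}

/-- **The orbit tube is a neighbourhood of every orbit point** when the chart is open at the origin: `Θ(K × B) ⊇
Θ'(Φ × B)`, a neighbourhood of `σ 0 = Θ'(0,0)`, and `k • ·` is a homeomorphism carrying the tube to itself.
[cite: Bredon1972, Ch. II §§4–5] [cite: DearricottEtAl2014, (Searle) Def. 1.11 and properties (1)–(3), PDF pp. 34–35] -/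
theorem tube_mem_nhds_orbit
    (hact : Continuous fun p : K × X => act p.1 p.2)
    (hmul : ∀ k k' x, act (k * k') x = act k (act k' x)) (hone : ∀ x, act 1 x = x)
    (hΘ : ∀ k y, Θ (k, y) = act k (σ y)) (hΘ' : ∀ z y, Θ' (z, y) = act (e z) (σ y))
    (hΘ'𝓝 : 𝓝 (σ 0) ≤ map Θ' (𝓝 ((0 : Z), (0 : V)))) {B : Set V} (hB : B ∈ 𝓝 (0 : V)) (k : K) :
    Θ '' (univ ×ˢ B) ∈ 𝓝 (act k (σ 0)) := by
  have himg : Θ' '' (univ ×ˢ B) ∈ 𝓝 (σ 0) := hΘ'𝓝 (image_mem_map (prod_mem_nhds univ_mem hB))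
  have hsub : Θ' '' (univ ×ˢ B) ⊆ Θ '' (univ ×ˢ B) := by
    rintro x ⟨⟨z, y⟩, ⟨-, hy⟩, rfl⟩
    exact ⟨(e z, y), ⟨mem_univ _, hy⟩, by rw [hΘ, hΘ']⟩
  have hT : Θ '' (univ ×ˢ B) ∈ 𝓝 (σ 0) := mem_of_superset himg hsub
  -- transport by the homeomorphism `act k` (inverse `act k⁻¹`)
  have hcont : Continuous (act k⁻¹) := hact.comp (continuous_const.prodMk continuous_id)
  have hpre : (act k⁻¹) ⁻¹' (Θ '' (univ ×ˢ B)) ∈ 𝓝 (act k (σ 0)) := by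
    refine hcont.continuousAt.preimage_mem_nhds ?_
    rw [act_inv_act hmul hone]
    exact hT
  refine mem_of_superset hpre fun x hx => ?_
  have hx' : act k (act k⁻¹ x) ∈ Θ '' (univ ×ˢ B) := (act_mem_tube_iff hmul hone hΘ k _).2 hx
  rwa [act_act_inv hmul hone] at hx'

end TubeNhds

/-! ## §2 One non-degenerate critical orbit, localised amplitude — structural hypotheses only -/

section OneOrbit

variable {V : Type*} [NormedAddCommGroup V] [InnerProductSpace ℝ V] [FiniteDimensional ℝ V]
  [MeasurableSpace V] [BorelSpace V]
variable {Z : Type*} [NormedAddCommGroup Z] [NormedSpace ℝ Z] [FiniteDimensional ℝ Z]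
  [MeasurableSpace Z] [BorelSpace Z]
variable {K : Type*} [Group K] [TopologicalSpace K] [IsTopologicalGroup K] [CompactSpace K]
  [FirstCountableTopology K] [MeasurableSpace K] [BorelSpace K]
variable {X : Type*} [TopologicalSpace X] [CompactSpace X] [T2Space X] [SecondCountableTopology X]
  [MeasurableSpace X] [BorelSpace X]
variable {act : K → X → X} {σ : V → X} {e : Z → K} {Θ : K × V → X} {Θ' : Z × V → X} {S : Set K}
  {ν : Measure K} [ν.IsHaarMeasure] {μ : Measure X} [IsFiniteMeasure μ]
  {κ : Measure Z} [SFinite κ] [IsFiniteMeasureOnCompacts κ]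

omit [CompactSpace X] [SecondCountableTopology X] [MeasurableSpace X] [BorelSpace X]
  [NormedSpace ℝ Z] [FiniteDimensional ℝ Z] [MeasurableSpace Z] [BorelSpace Z]
  [InnerProductSpace ℝ V] [FiniteDimensional ℝ V] [MeasurableSpace V] [BorelSpace V] in
/-- **The group-window constant is positive and finite**: in the structural setting (compact `K` with a Haar
measure `ν`, jointly continuous action, `σ` continuous, chart `Θ'(z, y) = e(z) • σ(y)` injective on a neighbourhood
`W` of the origin and open at the origin, `e` open at `0` with `e 0 = 1`, stabiliser of `σ 0` inside `S`, `S` fixing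
`σ(V)`), for every neighbourhood `Φ` of `0`: `0 < ν(((eΦ)·S)⁻¹) < ∞` — the constant `c` of
`tendsto_laplaceMethod_orbit`. [cite: Bredon1972, Ch. II §§4–5]
[cite: Helgason2000, Ch. I §1 Thm 1.14 p. 96 (Haar measure of a compact group: finite, inversion-invariant)] -/
theorem measure_windowConst_ne_zero_of_chart
    (hact : Continuous fun p : K × X => act p.1 p.2)
    (hmul : ∀ k k' x, act (k * k') x = act k (act k' x)) (hone : ∀ x, act 1 x = x)
    (hσ : Continuous σ) (he1 : e 0 = 1) (he𝓝 : 𝓝 (1 : K) ≤ map e (𝓝 0))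
    (hΘ' : ∀ z y, Θ' (z, y) = act (e z) (σ y)) (hΘ'𝓝 : 𝓝 (σ 0) ≤ map Θ' (𝓝 0))
    {W : Set (Z × V)} (hW : W ∈ 𝓝 (0 : Z × V)) (hinj : InjOn Θ' W)
    (hstab : ∀ k : K, act k (σ 0) = σ 0 → k ∈ S) (hfix : ∀ s ∈ S, ∀ y, act s (σ y) = σ y)
    {Φ : Set Z} (hΦ : Φ ∈ 𝓝 (0 : Z)) :
    ν (((e '' Φ) * S)⁻¹) ≠ 0 ∧ ν (((e '' Φ) * S)⁻¹) ≠ ∞ := by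
  haveI : IsInvInvariant ν := HaarLocalChart.isInvInvariant_of_isHaarMeasure ν
  obtain ⟨r₂, hr₂, hslice⟩ :=
    exists_ball_slice_of_chart hact hmul hone hσ.continuousAt he1 he𝓝 hΘ' hW hinj hstab hfix
  have hslice' : ∀ k : K, ∀ y ∈ ball (0 : V) r₂, ∀ y' ∈ ball (0 : V) r₂, act k (σ y) = σ y' → k ∈ S :=
    fun k y hy y' hy' h => (hslice k y hy y' hy' h).1
  refine ⟨?_, measure_ne_top ν _⟩
  rw [measure_inv]
  exact (measure_pos_of_mem_nhds ν
    (image_mul_mem_nhds_one_of_chart hact hmul hone hΘ' hΘ'𝓝 hΦ (ball_mem_nhds 0 hr₂) hslice')).ne'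

/-- ★★★ **Laplace's method on one non-degenerate critical orbit, localised amplitude — the compact ∕ continuous
edition.**  SETTING: `K` a compact first-countable topological group with a Haar measure `ν`; `X` a compact
second-countable Hausdorff space with a finite Borel measure `μ`; `act` a jointly continuous action of `K` on `X` by
`μ`-preserving maps; `σ : V → X` (finite-dimensional real inner product space, dimension `m`) and `e : Z → K`
(finite-dimensional parameter space with an s-finite Borel measure `κ` finite on compact sets) continuous, `e 0 = 1`,
`e` open at `0`; `Θ(k, y) = k • σ y` (the tube map), `Θ'(z, y) = e z • σ y` (the local product chart), `Θ'` open
at the origin; CHART DATA on an open window `W`: `Θ'` injective on `W`, a density `J ≥ 0` continuous on `W` with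
`μ|_{Θ'(W)} = Θ'_*((J · κ ⊗ dy)|_W)`, and a radius `ρ > 0` with `closedBall 0 ρ × {0} ⊆ W`; SLICE DATA: the stabiliser
of `σ 0` lies in `S ⊆ K` and `S` fixes `σ(V)` pointwise; PHASE DATA: `f, φ : X → ℝ` continuous and `act`-invariant,
`f(σ y) = f(σ 0) + ½⟪Ay, y⟫ + o(‖y‖²)` with `A` symmetric and `⟪Ay, y⟫ > 0` for `y ≠ 0`.
CONCLUSION: there is `r₁ > 0` such that for every `0 < r ≤ r₁`, with the tube `T_r = Θ(K × ball 0 r)`,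
`β^{m/2} ∫_X e^{−β(f − f(σ0))} 1_{T_r} φ dμ ⟶ (2π)^{m/2} · ν(K) · ((∫_{ball 0 ρ} J(z,0) dκ) ∕ ν(((e(ball 0 ρ))·S)⁻¹)) · φ(σ 0) ∕ √det A`.
All measurability ∕ integrability ∕ separation ∕ slice hypotheses of `tendsto_laplaceMethod_orbit_indicator` are
derived inside (§1); the density is replaced by its measurable modification `W.piecewise J 0` (equal on the windows).
[cite: HasenpflugRudolfSprungk2024, §3.1 Assumption 3 (M)(T), §3.4 and App. 4.1 Thm 16 ∕ Remark 17]
[cite: Hwang1980, main theorem (minimum set a compact manifold)]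
[cite: Breitung1994, Lemma 40 p. 55, Thm 41 p. 56 with §2.3 pp. 14–15]
[cite: Bredon1972, Ch. II §§4–5] [cite: DearricottEtAl2014, (Searle) Def. 1.11 and properties (1)–(7), PDF pp. 34–35]
[cite: Helgason2000, Ch. I §1 Thm 1.14 p. 96 (compact groups are unimodular)] -/
theorem tendsto_laplaceMethod_orbit_indicator_of_continuous
    (hact : Continuous fun p : K × X => act p.1 p.2)
    (hmul : ∀ k k' x, act (k * k') x = act k (act k' x)) (hone : ∀ x, act 1 x = x)
    (hpres : ∀ k, MeasurePreserving (act k) μ μ)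
    (hσ : Continuous σ) (he : Continuous e) (he1 : e 0 = 1) (he𝓝 : 𝓝 (1 : K) ≤ map e (𝓝 0))
    (hΘ : ∀ k y, Θ (k, y) = act k (σ y)) (hΘ' : ∀ z y, Θ' (z, y) = act (e z) (σ y))
    (hΘ'𝓝 : 𝓝 (σ 0) ≤ map Θ' (𝓝 0))
    {W : Set (Z × V)} (hWo : IsOpen W) (hinj : InjOn Θ' W)
    {J : Z × V → ℝ} (hJc : ContinuousOn J W) (hJ0 : ∀ w ∈ W, 0 ≤ J w)
    (hchart : μ.restrict (Θ' '' W) =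
      (((κ.prod volume).restrict W).withDensity fun w => ENNReal.ofReal (J w)).map Θ')
    {ρ : ℝ} (hρ : 0 < ρ) (hρW : closedBall (0 : Z) ρ ×ˢ {(0 : V)} ⊆ W)
    (hstab : ∀ k : K, act k (σ 0) = σ 0 → k ∈ S) (hfix : ∀ s ∈ S, ∀ y, act s (σ y) = σ y)
    {f φ : X → ℝ} (hf : Continuous f) (hφ : Continuous φ)
    (hfinv : ∀ k x, f (act k x) = f x) (hφinv : ∀ k x, φ (act k x) = φ x)
    {A : V →ₗ[ℝ] V} (hAs : A.IsSymmetric) (hpos : ∀ y, y ≠ 0 → 0 < ⟪A y, y⟫_ℝ)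
    (hS2 : (fun y => f (σ y) - f (σ 0) - (1 / 2) * ⟪A y, y⟫_ℝ) =o[𝓝 0] fun y => ‖y‖ ^ 2) :
    ∃ r₁ : ℝ, 0 < r₁ ∧ ∀ r : ℝ, 0 < r → r ≤ r₁ →
      Tendsto (fun β : ℝ => β ^ ((finrank ℝ V : ℝ) / 2) *
          ∫ x, Real.exp (-β * (f x - f (σ 0))) * (Θ '' (univ ×ˢ ball (0 : V) r)).indicator φ x ∂μ) atTop
        (𝓝 ((2 * π) ^ ((finrank ℝ V : ℝ) / 2) * (ν.real univ *
          ((∫ z in ball (0 : Z) ρ, J (z, 0) ∂κ) / (ν (((e '' ball (0 : Z) ρ) * S)⁻¹)).toReal * φ (σ 0) /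
            Real.sqrt (LinearMap.det A))))) := by
  classical
  haveI : IsMulRightInvariant ν := HaarLocalChart.isMulRightInvariant_of_isHaarMeasure ν
  haveI : IsInvInvariant ν := HaarLocalChart.isInvInvariant_of_isHaarMeasure ν
  -- continuity ⇒ measurability
  have hΘc : Continuous Θ := by
    have h : Θ = fun p : K × V => act p.1 (σ p.2) := funext fun p => hΘ p.1 p.2
    rw [h]
    exact hact.comp (continuous_fst.prodMk (hσ.comp continuous_snd))
  have hΘ'c : Continuous Θ' := by
    have h : Θ' = fun p : Z × V => act (e p.1) (σ p.2) := funext fun p => hΘ' p.1 p.2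
    rw [h]
    exact hact.comp ((he.comp continuous_fst).prodMk (hσ.comp continuous_snd))
  have hactm : Measurable fun p : K × X => act p.1 p.2 := hact.measurable
  have hΘm : Measurable Θ := hΘc.measurable
  have hΘ'm : Measurable Θ' := hΘ'c.measurable
  have hσm : Measurable σ := hσ.measurable
  have hfm : Measurable f := hf.measurable
  have hφm : Measurable φ := hφ.measurable
  -- the window: `(0,0) ∈ W`, a compact box `closedBall ρ × closedBall r₀ ⊆ W`
  have h0W : ((0 : Z), (0 : V)) ∈ W := hρW ⟨mem_closedBall_self hρ.le, rfl⟩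
  have hWn : W ∈ 𝓝 ((0 : Z), (0 : V)) := hWo.mem_nhds h0W
  obtain ⟨u, v, -, hv, hsu, htv, huv⟩ :=
    generalized_tube_lemma (isCompact_closedBall (0 : Z) ρ) isCompact_singleton hWo hρW
  obtain ⟨r₀', hr₀', hball⟩ := Metric.isOpen_iff.1 hv 0 (htv (mem_singleton 0))
  have hr₀ : 0 < r₀' / 2 := by positivity
  have hsub : closedBall (0 : Z) ρ ×ˢ closedBall (0 : V) (r₀' / 2) ⊆ W := fun p hp =>
    huv ⟨hsu hp.1, hball (closedBall_subset_ball (by linarith) hp.2)⟩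
  -- the slice property on a small ball
  obtain ⟨r₂, hr₂, hslice⟩ :=
    exists_ball_slice_of_chart hact hmul hone hσ.continuousAt he1 he𝓝 hΘ' hWn hinj hstab hfix
  -- coercivity and the quadratic lower bound
  obtain ⟨c₁, hc₁, hcoer⟩ := exists_pos_mul_norm_sq_le_inner hAs hpos
  obtain ⟨r₃, hr₃, hquad⟩ := exists_ball_quadratic_lower_bound (σ := σ) (f := f) hc₁ hcoer hS2
  -- the averaged density on `Φ = ball 0 ρ`
  obtain ⟨hJint, hj, C, hC⟩ := density_window_data (κ := κ) hWo hJc hr₀ hsub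
  -- a bound for the amplitude
  obtain ⟨Cφ, hCφ⟩ := (isCompact_univ : IsCompact (univ : Set X)).exists_bound_of_continuousOn hφ.continuousOn
  refine ⟨min (r₀' / 2) (min r₂ r₃), lt_min hr₀ (lt_min hr₂ hr₃), fun r hr hr₁ => ?_⟩
  have hrr₀ : r ≤ r₀' / 2 := hr₁.trans (min_le_left _ _)
  have hrr₂ : r ≤ r₂ := hr₁.trans ((min_le_right _ _).trans (min_le_left _ _))
  have hrr₃ : r ≤ r₃ := hr₁.trans ((min_le_right _ _).trans (min_le_right _ _))
  set B : Set V := ball (0 : V) r with hBdef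
  set Φ : Set Z := ball (0 : Z) ρ with hΦdef
  have h0B : (0 : V) ∈ B := mem_ball_self hr
  have hBn : B ∈ 𝓝 (0 : V) := ball_mem_nhds 0 hr
  have hΦn : Φ ∈ 𝓝 (0 : Z) := ball_mem_nhds 0 hρ
  have hBW : ∀ z ∈ Φ, ∀ y ∈ B, (z, y) ∈ W := fun z hz y hy =>
    hsub ⟨ball_subset_closedBall hz, (closedBall_subset_closedBall hrr₀) (ball_subset_closedBall hy)⟩
  have hΦBW : Φ ×ˢ B ⊆ W := fun p hp => hBW p.1 hp.1 p.2 hp.2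
  -- the measurable modification of the density
  set J₁ : Z × V → ℝ := W.piecewise J (fun _ => 0) with hJ₁
  have hJ₁m : Measurable J₁ := hJc.measurable_piecewise continuousOn_const hWo.measurableSet
  have hJ₁W : ∀ w ∈ W, J₁ w = J w := fun w hw => piecewise_eq_of_mem _ _ _ hw
  have hchart₁ : μ.restrict (Θ' '' W) =
      (((κ.prod volume).restrict W).withDensity fun w => ENNReal.ofReal (J₁ w)).map Θ' := by
    have hae : (fun w => ENNReal.ofReal (J w)) =ᵐ[(κ.prod volume).restrict W] fun w => ENNReal.ofReal (J₁ w) :=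
      ae_restrict_of_forall_mem hWo.measurableSet fun w hw => by
        show ENNReal.ofReal (J w) = ENNReal.ofReal (J₁ w)
        rw [hJ₁W w hw]
    rw [hchart, withDensity_congr_ae hae]
  -- the hypotheses of `tendsto_laplaceMethod_orbit_indicator`
  have hslice' : ∀ k : K, ∀ y ∈ B, ∀ y' ∈ B, act k (σ y) = σ y' → k ∈ S := fun k y hy y' hy' h =>
    (hslice k y (ball_subset_ball hrr₂ hy) y' (ball_subset_ball hrr₂ hy') h).1
  have hfix' : ∀ s ∈ S, ∀ y ∈ B, act s (σ y) = σ y := fun s hs y _ => hfix s hs y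
  have hT : MeasurableSet (Θ '' (univ ×ˢ B)) := measurableSet_image_prod_ball hΘc isCompact_univ 0 r
  have hA : MeasurableSet (Θ' '' (Φ ×ˢ B)) := measurableSet_image_ball_prod_ball hΘ'c 0 ρ 0 r
  have hJ0' : ∀ z ∈ Φ, ∀ y ∈ B, 0 ≤ J₁ (z, y) := fun z hz y hy => by
    rw [hJ₁W _ (hBW z hz y hy)]
    exact hJ0 _ (hBW z hz y hy)
  have hJint' : ∀ y ∈ B, IntegrableOn (fun z => J₁ (z, y)) Φ κ := fun y hy =>
    (hJint y ((closedBall_subset_closedBall hrr₀) (ball_subset_closedBall hy))).congr_fun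
      (fun z hz => (hJ₁W _ (hBW z hz y hy)).symm) measurableSet_ball
  have hloc : μ.restrict (Θ' '' (Φ ×ˢ B)) =
      (((κ.prod volume).restrict (Φ ×ˢ B)).withDensity fun w => ENNReal.ofReal (J₁ w)).map Θ' :=
    chart_restrict_of_injOn_ofReal hΘ'm hinj hΦBW hA hchart₁
  obtain ⟨hc0, hctop⟩ := measure_windowConst_ne_zero_of_chart (ν := ν) hact hmul hone hσ he1 he𝓝 hΘ' hΘ'𝓝
    hWn hinj hstab hfix hΦn
  have hsep : ∀ δ : ℝ, 0 < δ → ∃ η : ℝ, 0 < η ∧ ∀ y ∈ B, δ ≤ ‖y‖ → f (σ 0) + η ≤ f (σ y) := by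
    intro δ hδ
    refine ⟨c₁ / 4 * δ ^ 2, by positivity, fun y hy hδy => ?_⟩
    have h1 := hquad y (ball_subset_ball hrr₃ hy)
    have h2 : c₁ / 4 * δ ^ 2 ≤ c₁ / 4 * ‖y‖ ^ 2 :=
      mul_le_mul_of_nonneg_left (pow_le_pow_left₀ hδ.le hδy 2) (by positivity)
    linarith
  have hj' : ContinuousAt (fun y => ∫ z in Φ, J₁ (z, y) ∂κ) 0 := by
    refine hj.congr ?_
    filter_upwards [closedBall_mem_nhds (0 : V) hr₀] with y hy
    exact setIntegral_congr_fun measurableSet_ball fun z hz =>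
      (hJ₁W _ (hsub ⟨ball_subset_closedBall hz, hy⟩)).symm
  have hφc : ContinuousAt (fun y => φ (σ y)) 0 := (hφ.comp hσ).continuousAt
  have hbound : ∀ y : V, ‖y‖ < r₀' / 2 → |(∫ z in Φ, J₁ (z, y) ∂κ) * φ (σ y)| ≤ C * Cφ := by
    intro y hy
    have hy' : y ∈ closedBall (0 : V) (r₀' / 2) := mem_closedBall_zero_iff.2 hy.le
    have h1 : (∫ z in Φ, J₁ (z, y) ∂κ) = ∫ z in Φ, J (z, y) ∂κ :=
      setIntegral_congr_fun measurableSet_ball fun z hz => hJ₁W _ (hsub ⟨ball_subset_closedBall hz, hy'⟩)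
    rw [h1, abs_mul]
    have h2 := hC y hy'
    have h3 : |φ (σ y)| ≤ Cφ := by simpa only [Real.norm_eq_abs] using hCφ (σ y) (mem_univ _)
    have hC0 : 0 ≤ C := (abs_nonneg _).trans (hC 0 (mem_closedBall_self hr₀.le))
    exact mul_le_mul h2 h3 (abs_nonneg _) hC0
  have hint : Integrable (fun x => Real.exp (-0 * f x) * φ x) μ := by
    have hc : Continuous fun x => Real.exp (-0 * f x) * φ x :=
      (Real.continuous_exp.comp (continuous_const.mul hf)).mul hφ
    exact (integrableOn_univ.1 (hc.continuousOn.integrableOn_compact isCompact_univ))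
  have hmain := tendsto_laplaceMethod_orbit_indicator (ν := ν) (κ := κ) hactm hmul hone hpres hσm hΘ hΘm hΘ'
    hΘ'm hslice' hfix' hT hA measurableSet_ball measurableSet_ball hr Subset.rfl hJ₁m hJ0' hJint' hloc hc0 hctop
    hAs hpos hfm hφm hfinv hφinv hS2 hsep hj' hφc hr₀ hbound hint
  have hJJ : (∫ z in Φ, J₁ (z, 0) ∂κ) = ∫ z in Φ, J (z, 0) ∂κ :=
    setIntegral_congr_fun measurableSet_ball fun z hz =>
      hJ₁W _ (hsub ⟨ball_subset_closedBall hz, mem_closedBall_self hr₀.le⟩)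
  rw [hJJ] at hmain
  exact hmain

end OneOrbit

/-! ## §3 Finitely many non-degenerate critical orbits: the full integral and the Gibbs ratio -/

section Compactness

variable {X : Type*} [TopologicalSpace X] [CompactSpace X] {f : X → ℝ} {f₀ : ℝ} {U : Set X}

/-- **Separation off a neighbourhood of the minimum set, by compactness**: `X` compact, `f` continuous with
`f ≥ f₀`, and `U` a neighbourhood of every point where `f = f₀`; then `f ≥ f₀ + η₀` off `U` for some `η₀ > 0`
(`f` attains its minimum on the compact set `X ∖ interior U`, and that minimum exceeds `f₀`).  This is the tail
condition (T) of the several-tube bookkeeping. [cite: HasenpflugRudolfSprungk2024, §3.1 Assumption 3 (T) and §3.4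
(`ℓ ≥ δ > 0` on `D = ℝ^d ∖ ⋃ N_i(ε)`)] [cite: Hwang1980, main theorem (hypothesis: `inf` of `f` off a neighbourhood of
the minimum set exceeds the minimum)] -/
theorem exists_pos_forall_le_of_notMem (hf : Continuous f) (hglob : ∀ x, f₀ ≤ f x)
    (hU : ∀ x, f x = f₀ → U ∈ 𝓝 x) : ∃ η₀ : ℝ, 0 < η₀ ∧ ∀ x, x ∉ U → f₀ + η₀ ≤ f x := by
  set D : Set X := (interior U)ᶜ with hD
  have hDc : IsCompact D := isOpen_interior.isClosed_compl.isCompact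
  rcases D.eq_empty_or_nonempty with hDe | hDne
  · refine ⟨1, one_pos, fun x hx => ?_⟩
    have hxD : x ∈ D := fun h => hx (interior_subset h)
    rw [hDe] at hxD
    exact absurd hxD (notMem_empty x)
  · obtain ⟨x₀, hx₀, hmin⟩ := hDc.exists_isMinOn hDne hf.continuousOn
    have hgt : f₀ < f x₀ := by
      rcases (hglob x₀).lt_or_eq with h | h
      · exact h
      · exact absurd (mem_interior_iff_mem_nhds.2 (hU x₀ h.symm)) hx₀
    refine ⟨f x₀ - f₀, sub_pos.2 hgt, fun x hx => ?_⟩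
    have hxD : x ∈ D := fun h => hx (interior_subset h)
    linarith [isMinOn_iff.1 hmin x hxD]

/-- A finite family of positive reals has a common positive lower bound. [folklore] -/
private theorem exists_pos_forall_le {α : Type*} [Finite α] {δ : α → ℝ} (hδ : ∀ a, 0 < δ a) :
    ∃ r : ℝ, 0 < r ∧ ∀ a, r ≤ δ a := by
  rcases isEmpty_or_nonempty α with hα | hα
  · exact ⟨1, one_pos, fun a => isEmptyElim a⟩
  · obtain ⟨a₀, ha₀⟩ := Finite.exists_min δ
    exact ⟨δ a₀, hδ a₀, ha₀⟩

end Compactness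

section Positivity

variable {Z : Type*} [MetricSpace Z] [ProperSpace Z] [MeasurableSpace Z] [OpensMeasurableSpace Z]
  {κ : Measure Z} [IsFiniteMeasureOnCompacts κ] [IsOpenPosMeasure κ]

/-- The integral over a ball of a non-negative integrable function which is continuous and positive at the centre is
positive (for a measure positive on open sets). [folklore] -/
private theorem setIntegral_ball_pos_of_continuousAt {g : Z → ℝ} {z₀ : Z} {ρ : ℝ} (hρ : 0 < ρ)
    (hg0 : ∀ z ∈ ball z₀ ρ, 0 ≤ g z) (hgc : ContinuousAt g z₀) (hg00 : 0 < g z₀)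
    (hgi : IntegrableOn g (ball z₀ ρ) κ) : 0 < ∫ z in ball z₀ ρ, g z ∂κ := by
  obtain ⟨δ, hδ, hδg⟩ := Metric.continuousAt_iff.1 hgc (g z₀ / 2) (by positivity)
  set δ' := min δ ρ with hδ'
  have hδ'pos : 0 < δ' := lt_min hδ hρ
  have hsub : ball z₀ δ' ⊆ ball z₀ ρ := ball_subset_ball (min_le_right _ _)
  have hlow : ∀ z ∈ ball z₀ δ', g z₀ / 2 ≤ g z := by
    intro z hz
    have h := hδg (lt_of_lt_of_le (mem_ball.1 hz) (min_le_left _ _))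
    rw [Real.dist_eq] at h
    linarith [(abs_lt.1 h).1]
  have hμ : 0 < κ.real (ball z₀ δ') :=
    ENNReal.toReal_pos (measure_ball_pos κ z₀ hδ'pos).ne'
      (lt_of_le_of_lt (measure_mono ball_subset_closedBall) (isCompact_closedBall z₀ δ').measure_lt_top).ne
  have h1 : g z₀ / 2 * κ.real (ball z₀ δ') ≤ ∫ z in ball z₀ δ', g z ∂κ := by
    have h := setIntegral_mono_on (integrableOn_const
      ((lt_of_le_of_lt (measure_mono ball_subset_closedBall) (isCompact_closedBall z₀ δ').measure_lt_top).ne))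
      (hgi.mono_set hsub) measurableSet_ball hlow
    rwa [setIntegral_const, smul_eq_mul, mul_comm] at h
  have h2 : (∫ z in ball z₀ δ', g z ∂κ) ≤ ∫ z in ball z₀ ρ, g z ∂κ :=
    setIntegral_mono_set hgi (ae_restrict_of_forall_mem measurableSet_ball hg0) (Eventually.of_forall hsub)
  have h0 : 0 < g z₀ / 2 * κ.real (ball z₀ δ') := by positivity
  linarith

end Positivity

section SeveralOrbits

variable {V : Type*} [NormedAddCommGroup V] [InnerProductSpace ℝ V] [FiniteDimensional ℝ V]
  [MeasurableSpace V] [BorelSpace V]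
variable {Z : Type*} [NormedAddCommGroup Z] [NormedSpace ℝ Z] [FiniteDimensional ℝ Z]
  [MeasurableSpace Z] [BorelSpace Z]
variable {K : Type*} [Group K] [TopologicalSpace K] [IsTopologicalGroup K] [CompactSpace K]
  [FirstCountableTopology K] [MeasurableSpace K] [BorelSpace K]
variable {X : Type*} [TopologicalSpace X] [CompactSpace X] [T2Space X] [SecondCountableTopology X]
  [MeasurableSpace X] [BorelSpace X]
variable {ι : Type*} [Fintype ι]
  {act : K → X → X} {σ : ι → V → X} {e : Z → K} {Θ : ι → K × V → X} {Θ' : ι → Z × V → X} {S : ι → Set K}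
  {ν : Measure K} [ν.IsHaarMeasure] {μ : Measure X} [IsFiniteMeasure μ]
  {κ : Measure Z} [SFinite κ] [IsFiniteMeasureOnCompacts κ]

/-- ★★★ **Laplace's method with finitely many non-degenerate critical orbits — the compact ∕ continuous edition.**
SETTING as in `tendsto_laplaceMethod_orbit_indicator_of_continuous`, for a finite family of transversals
`σ_i : V → X` (`i ∈ ι`) through points `σ_i 0` with PAIRWISE DISTINCT orbits, one common group chart `e : Z → K`,
per-orbit tube maps `Θ_i(k, y) = k • σ_i y`, local product charts `Θ'_i(z, y) = e z • σ_i y` open at the origin with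
chart data `(W_i, J_i, hchart_i)`, radii `ρ_i`, slice data `S_i`, Hessians `A_i` (symmetric, positive definite) with
the Peano expansions of `f ∘ σ_i` at `0`.  GLOBAL PHASE DATA: `f, φ` continuous and invariant, `f(σ_i 0) = f₀` for
all `i`, `f ≥ f₀` on `X`, and the minimum set `{f = f₀}` is contained in the union of the orbits `K • σ_i(0)`.
CONCLUSION:
`β^{m/2} ∫_X e^{−β(f − f₀)} φ dμ ⟶ Σ_i (2π)^{m/2} ν(K) ((∫_{ball ρ_i} J_i(z,0)dκ) ∕ ν(((e(ball ρ_i))·S_i)⁻¹)) φ(σ_i 0) ∕ √det A_i`.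
Derived inside: a common tube radius making the tubes `Θ_i(K × ball 0 r)` pairwise disjoint
(`exists_pos_forall_act_ne`), the tail bound `f ≥ f₀ + η₀` off their union (compactness,
`exists_pos_forall_le_of_notMem`, the tubes being neighbourhoods of the orbits), the per-tube limits (§2), and the
bookkeeping `tendsto_laplaceMethod_sum_of_tubes`.
[cite: HasenpflugRudolfSprungk2024, §3.1 Assumption 3 (M)(T), §3.4 and App. 4.1 Thm 16 ∕ Remark 17]
[cite: Breitung1994, Thm 56 (6.31) (several minimum points: the contributions add) with Thm 41 p. 56]
[cite: Hwang1980, main theorem (minimum set a compact manifold, possibly disconnected)]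
[cite: Bredon1972, Ch. II §§4–5] [cite: DearricottEtAl2014, (Searle) Def. 1.11 and properties (1)–(7), PDF pp. 34–35] -/
theorem tendsto_laplaceMethod_sum_orbits_of_continuous
    (hact : Continuous fun p : K × X => act p.1 p.2)
    (hmul : ∀ k k' x, act (k * k') x = act k (act k' x)) (hone : ∀ x, act 1 x = x)
    (hpres : ∀ k, MeasurePreserving (act k) μ μ)
    (hσ : ∀ i, Continuous (σ i)) (he : Continuous e) (he1 : e 0 = 1) (he𝓝 : 𝓝 (1 : K) ≤ map e (𝓝 0))
    (hΘ : ∀ i k y, Θ i (k, y) = act k (σ i y)) (hΘ' : ∀ i z y, Θ' i (z, y) = act (e z) (σ i y))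
    (hΘ'𝓝 : ∀ i, 𝓝 (σ i 0) ≤ map (Θ' i) (𝓝 0))
    {W : ι → Set (Z × V)} (hWo : ∀ i, IsOpen (W i)) (hinj : ∀ i, InjOn (Θ' i) (W i))
    {J : ι → Z × V → ℝ} (hJc : ∀ i, ContinuousOn (J i) (W i)) (hJ0 : ∀ i, ∀ w ∈ W i, 0 ≤ J i w)
    (hchart : ∀ i, μ.restrict (Θ' i '' W i) =
      (((κ.prod volume).restrict (W i)).withDensity fun w => ENNReal.ofReal (J i w)).map (Θ' i))
    {ρ : ι → ℝ} (hρ : ∀ i, 0 < ρ i) (hρW : ∀ i, closedBall (0 : Z) (ρ i) ×ˢ {(0 : V)} ⊆ W i)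
    (hstab : ∀ i (k : K), act k (σ i 0) = σ i 0 → k ∈ S i) (hfix : ∀ i, ∀ s ∈ S i, ∀ y, act s (σ i y) = σ i y)
    {f φ : X → ℝ} (hf : Continuous f) (hφ : Continuous φ)
    (hfinv : ∀ k x, f (act k x) = f x) (hφinv : ∀ k x, φ (act k x) = φ x)
    {A : ι → V →ₗ[ℝ] V} (hAs : ∀ i, (A i).IsSymmetric) (hpos : ∀ i y, y ≠ 0 → 0 < ⟪A i y, y⟫_ℝ)
    (hS2 : ∀ i, (fun y => f (σ i y) - f (σ i 0) - (1 / 2) * ⟪A i y, y⟫_ℝ) =o[𝓝 0] fun y => ‖y‖ ^ 2)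
    {f₀ : ℝ} (hf₀ : ∀ i, f (σ i 0) = f₀) (hglob : ∀ x, f₀ ≤ f x)
    (hzero : ∀ x, f x = f₀ → ∃ i k, act k (σ i 0) = x)
    (hdist : ∀ i j, i ≠ j → ∀ k : K, act k (σ i 0) ≠ σ j 0) :
    Tendsto (fun β : ℝ => β ^ ((finrank ℝ V : ℝ) / 2) * ∫ x, Real.exp (-β * (f x - f₀)) * φ x ∂μ) atTop
      (𝓝 (∑ i, (2 * π) ^ ((finrank ℝ V : ℝ) / 2) * (ν.real univ *
          ((∫ z in ball (0 : Z) (ρ i), J i (z, 0) ∂κ) / (ν (((e '' ball (0 : Z) (ρ i)) * S i)⁻¹)).toReal *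
            φ (σ i 0) / Real.sqrt (LinearMap.det (A i)))))) := by
  classical
  -- per-orbit radii and limits (§2)
  choose r₁ hr₁ hlim using fun i => tendsto_laplaceMethod_orbit_indicator_of_continuous (ν := ν) (κ := κ)
    hact hmul hone hpres (hσ i) he he1 he𝓝 (hΘ i) (hΘ' i) (hΘ'𝓝 i) (hWo i) (hinj i) (hJc i) (hJ0 i)
    (hchart i) (hρ i) (hρW i) (hstab i) (hfix i) hf hφ hfinv hφinv (hAs i) (hpos i) (hS2 i)
  -- separation radii for the pairs of distinct orbits
  have hpair : ∀ p : {p : ι × ι // p.1 ≠ p.2}, ∃ r : ℝ, 0 < r ∧ ∀ (k k' : K) (y y' : V), ‖y‖ < r → ‖y'‖ < r →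
      act k (σ p.1.1 y) ≠ act k' (σ p.1.2 y') := fun p =>
    exists_pos_forall_act_ne hact (hσ p.1.1).continuousAt (hσ p.1.2).continuousAt fun k k' h =>
      hdist p.1.1 p.1.2 p.2 (k'⁻¹ * k) (by rw [hmul, h, act_inv_act hmul hone])
  choose r₂ hr₂ hsep₂ using hpair
  obtain ⟨ra, hra, hra₁⟩ := exists_pos_forall_le hr₁
  obtain ⟨rb, hrb, hrb₂⟩ := exists_pos_forall_le hr₂
  have hr : 0 < min ra rb := lt_min hra hrb
  -- the tubes of the common radius `min ra rb`
  have hΘc : ∀ i, Continuous (Θ i) := fun i => by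
    have h : Θ i = fun p : K × V => act p.1 (σ i p.2) := funext fun p => hΘ i p.1 p.2
    rw [h]
    exact hact.comp (continuous_fst.prodMk ((hσ i).comp continuous_snd))
  have hT : ∀ i, MeasurableSet (Θ i '' (univ ×ˢ ball (0 : V) (min ra rb))) := fun i =>
    measurableSet_image_prod_ball (hΘc i) isCompact_univ 0 _
  have hdisj : Pairwise fun i j => Disjoint (Θ i '' (univ ×ˢ ball (0 : V) (min ra rb)))
      (Θ j '' (univ ×ˢ ball (0 : V) (min ra rb))) := by
    intro i j hij
    exact disjoint_tubes_of_forall_act_ne (hΘ i) (hΘ j) (hsep₂ ⟨(i, j), hij⟩)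
      (ball_subset_ball ((min_le_right _ _).trans (hrb₂ ⟨(i, j), hij⟩)))
      (ball_subset_ball ((min_le_right _ _).trans (hrb₂ ⟨(i, j), hij⟩)))
  -- the tail bound off the union of the tubes, by compactness
  have hUnhds : ∀ x, f x = f₀ → (⋃ i, Θ i '' (univ ×ˢ ball (0 : V) (min ra rb))) ∈ 𝓝 x := by
    intro x hx
    obtain ⟨i, k, rfl⟩ := hzero x hx
    exact mem_of_superset
      (tube_mem_nhds_orbit hact hmul hone (hΘ i) (hΘ' i) (hΘ'𝓝 i) (ball_mem_nhds 0 hr) k)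
      (subset_iUnion (fun i => Θ i '' (univ ×ˢ ball (0 : V) (min ra rb))) i)
  obtain ⟨η₀, hη₀, hout⟩ := exists_pos_forall_le_of_notMem hf hglob hUnhds
  -- integrability of the weight (`β₀ = 0`)
  have hint : Integrable (fun x => Real.exp (-0 * f x) * φ x) μ := by
    have hc : Continuous fun x => Real.exp (-0 * f x) * φ x :=
      (Real.continuous_exp.comp (continuous_const.mul hf)).mul hφ
    exact (integrableOn_univ.1 (hc.continuousOn.integrableOn_compact isCompact_univ))
  refine tendsto_laplaceMethod_sum_of_tubes _ hf.measurable hφ.measurable hT hdisj (fun x _ => hglob x) hη₀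
    (fun x hx _ => hout x hx) hint fun i => ?_
  have h := hlim i (min ra rb) hr ((min_le_left _ _).trans (hra₁ i))
  rw [hf₀ i] at h
  exact h

/-- ★ **Gibbs expectations concentrate on the critical orbits**: under the hypotheses of
`tendsto_laplaceMethod_sum_orbits_of_continuous` with `ι` non-empty, `κ` positive on open sets and `J_i(0,0) > 0`
(so that every orbit constant is positive), the normalised means converge,
`∫ e^{−βf} φ dμ ∕ ∫ e^{−βf} dμ ⟶ (Σ_i ℓ_i(φ)) ∕ (Σ_i ℓ_i(1))`, `ℓ_i(ψ)` the one-orbit constants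
`(2π)^{m/2} ν(K) ((∫_{ball ρ_i} J_i(z,0)dκ) ∕ ν(((e(ball ρ_i))·S_i)⁻¹)) ψ(σ_i 0) ∕ √det A_i` (the weights of the
vacua in the `β → ∞` state). [cite: Hwang1980, main theorem and its corollary (the weak limit of `e^{−nℓ}dμ₀ ∕ Z_n`
is carried by the minimum set with density `∝ π₀ · det^{−1/2}`)]
[cite: HasenpflugRudolfSprungk2024, §3.4 (the limit measure on `⋃_i M_i`)] [cite: Breitung1994, Thm 56 (6.31)] -/
theorem tendsto_gibbs_expectation_sum_orbits_of_continuous [Nonempty ι] [IsOpenPosMeasure κ]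
    (hact : Continuous fun p : K × X => act p.1 p.2)
    (hmul : ∀ k k' x, act (k * k') x = act k (act k' x)) (hone : ∀ x, act 1 x = x)
    (hpres : ∀ k, MeasurePreserving (act k) μ μ)
    (hσ : ∀ i, Continuous (σ i)) (he : Continuous e) (he1 : e 0 = 1) (he𝓝 : 𝓝 (1 : K) ≤ map e (𝓝 0))
    (hΘ : ∀ i k y, Θ i (k, y) = act k (σ i y)) (hΘ' : ∀ i z y, Θ' i (z, y) = act (e z) (σ i y))
    (hΘ'𝓝 : ∀ i, 𝓝 (σ i 0) ≤ map (Θ' i) (𝓝 0))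
    {W : ι → Set (Z × V)} (hWo : ∀ i, IsOpen (W i)) (hinj : ∀ i, InjOn (Θ' i) (W i))
    {J : ι → Z × V → ℝ} (hJc : ∀ i, ContinuousOn (J i) (W i)) (hJ0 : ∀ i, ∀ w ∈ W i, 0 ≤ J i w)
    (hJ00 : ∀ i, 0 < J i 0)
    (hchart : ∀ i, μ.restrict (Θ' i '' W i) =
      (((κ.prod volume).restrict (W i)).withDensity fun w => ENNReal.ofReal (J i w)).map (Θ' i))
    {ρ : ι → ℝ} (hρ : ∀ i, 0 < ρ i) (hρW : ∀ i, closedBall (0 : Z) (ρ i) ×ˢ {(0 : V)} ⊆ W i)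
    (hstab : ∀ i (k : K), act k (σ i 0) = σ i 0 → k ∈ S i) (hfix : ∀ i, ∀ s ∈ S i, ∀ y, act s (σ i y) = σ i y)
    {f φ : X → ℝ} (hf : Continuous f) (hφ : Continuous φ)
    (hfinv : ∀ k x, f (act k x) = f x) (hφinv : ∀ k x, φ (act k x) = φ x)
    {A : ι → V →ₗ[ℝ] V} (hAs : ∀ i, (A i).IsSymmetric) (hpos : ∀ i y, y ≠ 0 → 0 < ⟪A i y, y⟫_ℝ)
    (hS2 : ∀ i, (fun y => f (σ i y) - f (σ i 0) - (1 / 2) * ⟪A i y, y⟫_ℝ) =o[𝓝 0] fun y => ‖y‖ ^ 2)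
    {f₀ : ℝ} (hf₀ : ∀ i, f (σ i 0) = f₀) (hglob : ∀ x, f₀ ≤ f x)
    (hzero : ∀ x, f x = f₀ → ∃ i k, act k (σ i 0) = x)
    (hdist : ∀ i j, i ≠ j → ∀ k : K, act k (σ i 0) ≠ σ j 0) :
    Tendsto (fun β : ℝ => (∫ x, Real.exp (-β * f x) * φ x ∂μ) / ∫ x, Real.exp (-β * f x) ∂μ) atTop
      (𝓝 ((∑ i, (2 * π) ^ ((finrank ℝ V : ℝ) / 2) * (ν.real univ *
          ((∫ z in ball (0 : Z) (ρ i), J i (z, 0) ∂κ) / (ν (((e '' ball (0 : Z) (ρ i)) * S i)⁻¹)).toReal *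
            φ (σ i 0) / Real.sqrt (LinearMap.det (A i))))) /
        ∑ i, (2 * π) ^ ((finrank ℝ V : ℝ) / 2) * (ν.real univ *
          ((∫ z in ball (0 : Z) (ρ i), J i (z, 0) ∂κ) / (ν (((e '' ball (0 : Z) (ρ i)) * S i)⁻¹)).toReal /
            Real.sqrt (LinearMap.det (A i)))))) := by
  classical
  haveI : IsMulRightInvariant ν := HaarLocalChart.isMulRightInvariant_of_isHaarMeasure ν
  have hnum := tendsto_laplaceMethod_sum_orbits_of_continuous (ν := ν) (κ := κ) hact hmul hone hpres hσ he he1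
    he𝓝 hΘ hΘ' hΘ'𝓝 hWo hinj hJc hJ0 hchart hρ hρW hstab hfix hf hφ hfinv hφinv hAs hpos hS2 hf₀ hglob hzero hdist
  have hden := tendsto_laplaceMethod_sum_orbits_of_continuous (ν := ν) (κ := κ) (φ := fun _ => (1 : ℝ)) hact hmul
    hone hpres hσ he he1 he𝓝 hΘ hΘ' hΘ'𝓝 hWo hinj hJc hJ0 hchart hρ hρW hstab hfix hf continuous_const hfinv
    (fun _ _ => rfl) hAs hpos hS2 hf₀ hglob hzero hdist
  simp only [mul_one] at hden
  -- every orbit constant is positive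
  have hνpos : 0 < ν.real univ :=
    ENNReal.toReal_pos (IsOpenPosMeasure.open_pos univ isOpen_univ univ_nonempty) (measure_ne_top ν _)
  have hCpos : ∀ i, 0 < (2 * π) ^ ((finrank ℝ V : ℝ) / 2) * (ν.real univ *
      ((∫ z in ball (0 : Z) (ρ i), J i (z, 0) ∂κ) / (ν (((e '' ball (0 : Z) (ρ i)) * S i)⁻¹)).toReal /
        Real.sqrt (LinearMap.det (A i)))) := by
    intro i
    have h0W : ((0 : Z), (0 : V)) ∈ W i := hρW i ⟨mem_closedBall_self (hρ i).le, rfl⟩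
    have hWn : W i ∈ 𝓝 ((0 : Z), (0 : V)) := (hWo i).mem_nhds h0W
    obtain ⟨hc0, hctop⟩ := measure_windowConst_ne_zero_of_chart (ν := ν) hact hmul hone (hσ i) he1 he𝓝 (hΘ' i)
      (hΘ'𝓝 i) hWn (hinj i) (hstab i) (hfix i) (ball_mem_nhds (0 : Z) (hρ i))
    have hc : 0 < (ν (((e '' ball (0 : Z) (ρ i)) * S i)⁻¹)).toReal := ENNReal.toReal_pos hc0 hctop
    have hdet : 0 < LinearMap.det (A i) := det_pos_of_inner_pos (hAs i) (hpos i)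
    have hJcont : ContinuousOn (fun z => J i (z, 0)) (closedBall (0 : Z) (ρ i)) :=
      (hJc i).comp (continuous_id.prodMk continuous_const).continuousOn fun z hz => hρW i ⟨hz, rfl⟩
    have hI : 0 < ∫ z in ball (0 : Z) (ρ i), J i (z, 0) ∂κ :=
      setIntegral_ball_pos_of_continuousAt (hρ i)
        (fun z hz => hJ0 i _ (hρW i ⟨ball_subset_closedBall hz, rfl⟩))
        (hJcont.continuousAt (closedBall_mem_nhds (0 : Z) (hρ i)))
        (hJ00 i) ((hJcont.integrableOn_compact (isCompact_closedBall _ _)).mono_set ball_subset_closedBall)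
    positivity
  have hne : (∑ i, (2 * π) ^ ((finrank ℝ V : ℝ) / 2) * (ν.real univ *
      ((∫ z in ball (0 : Z) (ρ i), J i (z, 0) ∂κ) / (ν (((e '' ball (0 : Z) (ρ i)) * S i)⁻¹)).toReal /
        Real.sqrt (LinearMap.det (A i))))) ≠ 0 :=
    (Finset.sum_pos (fun i _ => hCpos i) Finset.univ_nonempty).ne'
  have hq := hnum.div hden hne
  refine hq.congr' ?_
  filter_upwards [eventually_gt_atTop 0] with β hβ
  have key : ∀ ψ : X → ℝ, (∫ x, Real.exp (-β * f x) * ψ x ∂μ) =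
      Real.exp (-β * f₀) * ∫ x, Real.exp (-β * (f x - f₀)) * ψ x ∂μ := by
    intro ψ
    rw [← integral_const_mul]
    refine integral_congr_ae (Eventually.of_forall fun x => ?_)
    show Real.exp (-β * f x) * ψ x = Real.exp (-β * f₀) * (Real.exp (-β * (f x - f₀)) * ψ x)
    rw [← mul_assoc, ← Real.exp_add]
    congr 2
    ring
  have key1 : (∫ x, Real.exp (-β * f x) ∂μ) = Real.exp (-β * f₀) * ∫ x, Real.exp (-β * (f x - f₀)) ∂μ := by
    have h := key fun _ => (1 : ℝ)
    simpa only [mul_one] using h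
  have hpow : β ^ ((finrank ℝ V : ℝ) / 2) ≠ 0 := by positivity
  have hexp : Real.exp (-β * f₀) ≠ 0 := (Real.exp_pos _).ne'
  simp only [Pi.div_apply]
  rw [mul_div_mul_left _ _ hpow, key φ, key1, mul_div_mul_left _ _ hexp]

end SeveralOrbits

end Literature.Analysis.Asymptotics
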